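import Literature.NumberTheory.EllipticCurves.BSDQuadraticDescent
import Literature.NumberTheory.EllipticCurves.AnalyticRankModularityProofs
import HarnessLib

/-!
# `L(E, 1) ≥ 0`: reduction of `WeierstrassCurve.re_entireLFunction_one_nonneg` to modularity
# and the central-value theorem for weight-`2` newforms

`Proofs` sibling (theorems only, no new named facts) of
`Literature.NumberTheory.EllipticCurves.BSDQuadraticDescent`, concerning its named fact
`WeierstrassCurve.re_entireLFunction_one_nonneg` (`0 ≤ re L(E, 1)` for every elliptic curve
`E / ℚ`; Lapid–Rallis 2003, Thm. 1 for `n = 2`, i.e. Guo 1996).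

The printed proof of that fact for an elliptic curve has exactly two inputs
(docstring of the fact; Lapid–Rallis 2003, Introduction, arXiv p. 2):

1. **modularity** (Breuil–Conrad–Diamond–Taylor 2001, Thm. A; Diamond–Shurman Thm. 8.8.3):
   `L(E, s) = L(f, s)` for a newform `f ∈ S₂(Γ₀(N_E))` — the tree's named fact
   `Literature.NumberTheory.EllipticCurves.ModularForms.exists_isNewformOf`;
2. the **central-value theorem on `GL₂` with trivial central character**: *"Theorem 1. Let `π`
   be a symplectic cuspidal representation of `GL_n(𝔸)`. Then `L(½, π) ≥ 0`. We note that the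
   same will be true for the partial `L`-function. … In the case `n = 2`, `π` is symplectic
   exactly when the central character of `π` is trivial. The above-mentioned interpretations of
   `L(½, π)` were used to prove Theorem 1 in that case ([KZ81], [KS93], using the Shimura
   correspondence in special cases, and [Guo96], using a variant of Jacquet's relative trace
   formula, in general)"* (Lapid–Rallis 2003, Thm. 1 and Introduction, arXiv p. 2). For the
   cuspidal representation `π_f` of a newform `f ∈ S₂(Γ₀(N))` (trivial nebentypus, hence trivial
   central character) the finite part of `L(s, π_f)` is `L(f, s + ½)`, so the statement reads:
   the entire continuation of `L(f, s) = ∑ aₙ(f) n⁻ˢ` (Hecke) has non-negative real value at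
   `s = 1`.

Input 2 has no formal counterpart (Mathlib has no automorphic representations, Shimura
correspondence or relative trace formula), and D-0026 forbids minting it as a new named fact from
this seat; input 1 is an unproved named fact of the tree. This file proves the **glue**, i.e. the
implication "1 ∧ 2 ⇒ `re_entireLFunction_one_nonneg`", with input 2 as an explicit hypothesis
stated for weight-`2` newforms on `Γ₀(N)` in the tree's vocabulary
(`IsNewform0`, `cuspFormLSeries`):

* `WeierstrassCurve.re_entireLFunction_one_nonneg_of_newform_central_value_nonneg`.

The argument: for elliptic `W / ℚ`, `N_W ≥ 1` (`conductorNorm_pos_holds`); modularity gives the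
newform `f` of `W`; then `W.HasEntireLFunction` (`hasEntireLFunction_rat_of_exists_isNewformOf`:
Hecke's continuation of `L(f, s)` with Rankin's abscissa `3/2`), so `W.entireLFunction` is an
entire function (`differentiable_entireLFunction`) which agrees with `L(f, s)` on `re s > 3/2`
(`IsNewformOf.entireLFunction_eq_holds`), in particular on Hecke's half-plane `re s > 2`; input 2
applied to this continuation gives `0 ≤ re (W.entireLFunction 1)`.

## References

* E. Lapid, S. Rallis, *On the nonnegativity of `L(½, π)` for `SO_{2n+1}`*, Ann. of Math. 157
  (2003), 891–917, Thm. 1 and Introduction (arXiv math/0402371, p. 2). [LapidRallis2003]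
* J. Guo, *On the positivity of the central critical values of automorphic `L`-functions for
  `GL(2)`*, Duke Math. J. 83 (1996), 157–190. [Guo1996]
* C. Breuil, B. Conrad, F. Diamond, R. Taylor, J. Amer. Math. Soc. 14 (2001), 843–939, Thm. A.
  [BCDTJAMS2001]
* F. Diamond, J. Shurman, *A first course in modular forms*, GTM 228 (2005), Thm. 5.10.2,
  Thm. 8.8.3. [DiamondShurman2005]
-/

noncomputable section

open scoped MatrixGroups

open CongruenceSubgroup Literature.NumberTheory.EllipticCurves.ModularForms Complex

namespace WeierstrassCurve

/-- **`L(E, 1) ≥ 0` from modularity and the `GL₂` central-value theorem.** Assume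
(1) the modularity theorem `exists_isNewformOf` (Breuil–Conrad–Diamond–Taylor 2001, Thm. A;
Diamond–Shurman Thm. 8.8.3) and (2) Lapid–Rallis 2003, Thm. 1 for `n = 2` (= Guo 1996) in
classical language: for every newform `f ∈ S₂(Γ₀(N))` and every entire `L` with
`L(s) = L(f, s) = ∑ aₙ(f) n⁻ˢ` for `re s > 2`, `0 ≤ re L(1)` (*"Let `π` be a symplectic cuspidal
representation of `GL_n(𝔸)`. Then `L(½, π) ≥ 0`. … the same will be true for the partial
`L`-function. … In the case `n = 2`, `π` is symplectic exactly when the central character of `π`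
is trivial"*, loc. cit., applied to `π_f`, whose finite `L`-function is `L(f, s + ½)`). Then
`0 ≤ re L(E, 1)` for every elliptic curve `E / ℚ`, `L(E, ·) = W.entireLFunction` being the entire
continuation of `L(E, s)`: it *is* the entire continuation of `L(f, s)` for the newform `f` of
`E` (`IsNewformOf.entireLFunction_eq_holds`, `hasEntireLFunction_rat_of_exists_isNewformOf`).
[cite: LapidRallis2003, Thm. 1 (case n = 2) and Introduction (arXiv p. 2)] [cite: Guo1996]
[cite: BCDTJAMS2001, Theorem A] -/
theorem re_entireLFunction_one_nonneg_of_newform_central_value_nonneg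
    (hmod : exists_isNewformOf)
    (hGuo : ∀ {N : ℕ} [NeZero N] {f : CuspForm (Gamma0 N) 2}, IsNewform0 f →
      ∀ {L : ℂ → ℂ}, Differentiable ℂ L →
        (∀ s : ℂ, (2 : ℝ) < s.re → L s = cuspFormLSeries f s) → 0 ≤ (L 1).re) :
    re_entireLFunction_one_nonneg := by
  intro W _
  haveI : NeZero (W.conductorNorm ℤ) := ⟨(W.conductorNorm_pos_holds).ne'⟩
  obtain ⟨f, hf⟩ := hmod W
  exact hGuo hf.1 (W.differentiable_entireLFunction (hasEntireLFunction_rat_of_exists_isNewformOf hmod W))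
    fun s hs ↦ IsNewformOf.entireLFunction_eq_holds hf (by linarith)

end WeierstrassCurve
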